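import Summits.QuantumFields.YangMills.Theorems.Y2BridgeClay

/-!
# OSLegsAtWeakCouplingC / Y2Bridge (3/3) — the P2 window INSIDE the bridge: `IR ⇐ weak-coupling front ∧ β-uniform
# hand-over ∧ fronts meet`; the SU(2) instance at the certified door

HONEST FRAMING (cell `ym-beyond`, seat P2 «strong-coupling bridge», HUMAN RULING D-0035 / D-0037; tree edition g9,
2026-08-25, module 3 of 3 of the farm-checked HOME text `ROUTE-P2-Lift-Y2Bridge.lean` sha16 88dea3089e2d7187 = sketches
`ROUTE-P2-SketchY2v2.lean` 41ff3c804614185f + `ROUTE-P2-SketchSeq.lean` 71a1ab5bc548f5fc, referee baseline v0.7 PASS; memo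
`HOME/ROUTE-P2.md` §4f, §5; filed for the cell by the courier seat `ym-beyond-courier` per director-ym lines №1 (A), №3 (C)).  SUMMIT-SIDE SUPPORT
for the lead of crux `OSLegsAtWeakCouplingC`: NOTHING here is asserted about Yang–Mills — every binder is a HYPOTHESIS,
a statement about LATTICE Yang–Mills alone (Wilson's measure on odd tori `(ℤ/(2L+1))⁴`, tree coupling `β`, unit map
`a : ℝ → ℝ`) taken verbatim from the tree (`Cruxes.OSLegsFromFemtoAndGap.DlrCollarTransfer.*`,
`Theorems/LangevinControlUVOSLegsFromFemtoAndGapDefs.lean`, `…AtWeakCouplingCSketchRetype.lean`); every arrow is a TREE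
theorem used by name; no item is tagged or registered (the route owner's call).  NO `sorry`, no axiom beyond the
standard three.  WHAT THIS IS NOT: not a proof of any leg, not THE NUMBER (memo §2), not the venture-side door modules
(`Summits/Ventures/YMGap/YM4Door/*`).

CONTENTS.  §Window: `HandOverU F r β₀ m` (β-UNIFORM hand-over at the door `β₀` along a flow control `F : RGFlowControl`
of the crossover ledger; implies the ledger's `HandOver`), `BoundedDecrease` (two-sided step bound), the bookkeeping
theorem `gapInUnits_of_fronts` (along a weak-coupling front meeting a β-uniform hand-over the EXIT-SCALE unit map
`a(β) := L^(−k⋆(β))` is positive, tends to `0` and carries `GapInUnits` at rate `m`; the binder `hmeet : β_exit ≤ β₀` is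
where THE NUMBER of the memo enters — none certified in print: printed-chain floor `β_W ≥ e^44` against the ball door
`β_W,eff ≤ 1/3`), `yangMills_of_fronts` (Clay from the fronts plus the UV-side legs at the exit-scale unit map).  §SU2:
`AtTorusDoor`, `clustersWith_of_atTorusDoor`, `GibbsFormAtDoor` (H-b), the β- and b-UNIFORM observable transport
`ObservableTransportU` (H-c^U), `handOverU_of_split` (H-b ∧ H-c^U at the certified door `1/6` ⇒ `HandOverU`, tree row
`su2_torusClusteringOnBallW_star_oneThird_t100`), `gapInUnits_su2_of_split`, `osDataWithGap_su2_of_split`.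
PREVIOUS: `Y2BridgeKing.lean`, `Y2BridgeClay.lean`.  Hypothesis schemas only; nothing asserted.

References: T. Bałaban, CMP 119 (1988) 243–285 [Balaban1988Convergent]; K. Osterwalder, E. Seiler, Ann. Phys. 110 (1978)
440–471; the crossover ledger `Literature/…/Balaban1983to89/CrossoverLedger.lean`; the tree files above.
-/

set_option autoImplicit false

noncomputable section

open scoped SchwartzMap ComplexConjugate BigOperators
open MeasureTheory Filter Topology
open Literature.MathematicalPhysics.QuantumFieldTheory Literature.MathematicalPhysics.QuantumLattice
open Literature.MathematicalPhysics.AQFT Literature.Probability.LatticeModels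
open Summit.QuantumFields.YangMills.Cruxes.OSLegsFromFemtoAndGap.DlrCollarTransfer
open Summit.QuantumFields.YangMills.Cruxes.OSLegsAtWeakCouplingC.Sketch
open Summit.QuantumFields.YangMills.Theorems.OSLegsFromFemtoAndGap (isHermitian_of_isReflectionPositive latticeDist)
open Summit.QuantumFields.YangMills.Theorems.HypercubicLimit.Negative (onlySpecies latticeSchwinger_onlySpecies_self)
open Summit.QuantumFields.YangMills.Theorems.NPointIsotropy.Negative (E4)

namespace Summit.QuantumFields.YangMills.Cruxes.OSLegsAtWeakCouplingC.Y2Bridge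

/-! ## Part B — the P2 window INSIDE the bridge: `IR ⇐ weak-coupling front ∧ β-uniform hand-over ∧ fronts meet`

The crossover ledger's interface (`Balaban1983to89/CrossoverLedger.lean`: `RGFlowControl`, `WeakCouplingFront F β_exit`,
`HandOver F r β₀ m`, glue `massGap_of_frontsMeet`) speaks lattice rates at each fixed bare coupling.  The bridge's IR
binder `GapInUnits G r a` wants (i) ONE rate `c₁` in the units of a map `a(β) → 0` and (ii) constants `C_{AB}` uniform
in `β`.  Part B records the β-uniform form of the hand-over (`HandOverU`, which implies the ledger's `HandOver`), the
two-sided step bound the flow interface lacks (`BoundedDecrease`: B12 (0.20) read from both sides — without it the exit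
step need not diverge and `a ↛ 0`), and the bookkeeping theorem `gapInUnits_of_fronts`: along a weak-coupling front
meeting a β-uniform hand-over, the EXIT-SCALE unit map `a(β) := L^(−k⋆(β))` (`k⋆` = first step below `β_exit`) is
positive, tends to `0`, and carries `GapInUnits` at rate `m`.  Composed with Part A: `yangMills_of_fronts` — Clay from
the fronts plus the three UV-side legs asked AT THE FLOW'S OWN EXIT-SCALE UNIT MAP.  The numerical content of P2
(memo §2) is the distance between a certified `β_exit` (none in print; printed-chain floor `β_W ≥ e^44`) and a certified
hand-over door `β₀` (ball door `β_W,eff ≤ 1/3`, loads (11/500, 11/1000)); `hmeet : β_exit ≤ β₀` is where it enters.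
Hypothesis schemas only; nothing asserted. -/

namespace Window

open Literature.MathematicalPhysics.QuantumFieldTheory.Balaban1983to89.CrossoverLedger
  (RGFlowControl WeakCouplingFront HandOver ExponentialClustering)

variable {G : Type} [Group G] [TopologicalSpace G] [IsTopologicalGroup G] [CompactSpace G]
  [MeasurableSpace G] [BorelSpace G]

/-- **β-UNIFORM hand-over** (hypothesis schema, NOT in print — the ledger's `HandOver` with the constants the bridge
needs): ONE rate `m > 0`, volume thresholds `S₁(β, k)` independent of the observables, and for every pair of
gauge-invariant local observables ONE constant `C_{AB}` independent of `(β, k)`, such that whenever the `k`-th effective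
action of the flow from bare `β` is controlled with effective coupling `≤ β₀`, the BARE theory at `β` clusters on every
torus of half-side `S ≥ S₁(β, k)` at lattice rate `m / L^k`. -/
def HandOverU (F : RGFlowControl) (r : LatticeRep G) (β₀ m : ℝ) : Prop :=
  0 < m ∧ ∃ S₁ : ℝ → ℕ → ℕ, ∀ A B : YMSpecies G, ∃ C : ℝ, ∀ (β : ℝ) (k : ℕ),
    F.Controlled β k → F.betaEff β k ≤ β₀ → ∀ S : ℕ, S₁ β k ≤ S → ∀ n : ℕ, n ≤ S →
      |latticeConnectedCorr r.ρ β (2 * S + 1) A.F B.F n| ≤ C * Real.exp (-(m / (F.L : ℝ) ^ k * n))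

/-- The β-uniform hand-over implies the ledger's `HandOver` (it only forgets the uniformity of the constants). -/
theorem handOver_of_handOverU {F : RGFlowControl} {r : LatticeRep G} {β₀ m : ℝ} (h : HandOverU F r β₀ m) :
    HandOver F r β₀ m := by
  obtain ⟨hm, S₁, hS⟩ := h
  have hL : (0 : ℝ) < F.L := by exact_mod_cast (zero_lt_one.trans F.one_lt_L)
  refine ⟨hm, fun β k hc hb => ⟨div_pos hm (pow_pos hL _), fun A B => ?_⟩⟩
  obtain ⟨C, hC⟩ := hS A B
  exact ⟨C, S₁ β k, fun S hS' n hn => hC β k hc hb S hS' n hn⟩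

/-- **Two-sided step bound** (hypothesis schema): the effective coupling decreases by AT MOST `D` per step
(B12 (0.20): `1/g²_{k+1} = 1/g²_k − β_{k+1}(g_k)` with `β_{k+1}` bounded).  The ledger's `RGFlowControl.decr` is the
lower bound only; the upper bound is what makes the exit step diverge with `β`. -/
def BoundedDecrease (F : RGFlowControl) (D : ℝ) : Prop :=
  0 < D ∧ ∀ (β : ℝ) (k : ℕ), F.betaEff β k - D ≤ F.betaEff β (k + 1)

/-- **`IR ⇐ fronts`** (bookkeeping, proved): along a weak-coupling front at `β_exit` meeting (`β_exit ≤ β₀`) a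
β-uniform hand-over at `β₀` with rate `m`, with two-sided steps, there is a unit map `a` — the exit-scale map,
`a(β) = L^(−k⋆(β))` above the front with `k⋆(β)` the first step whose effective coupling is `< β_exit`, that step being
controlled — which is positive, tends to `0`, and carries `GapInUnits G r a` (rate `c₁ = m`, threshold `β₂ = β_exit`). -/
theorem gapInUnits_of_fronts (r : LatticeRep G) {F : RGFlowControl} {β₀ β_exit m D : ℝ}
    (hWC : WeakCouplingFront F β_exit) (hHO : HandOverU F r β₀ m) (hmeet : β_exit ≤ β₀)
    (hD : BoundedDecrease F D) :
    ∃ a : ℝ → ℝ, (∀ β, 0 < a β) ∧ Tendsto a atTop (𝓝 0) ∧ GapInUnits G r a ∧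
      ∀ β, β_exit ≤ β → ∃ k : ℕ, a β = ((F.L : ℝ) ^ k)⁻¹ ∧ F.Controlled β k ∧ F.betaEff β k < β_exit ∧
        ∀ j < k, β_exit ≤ F.betaEff β j := by
  classical
  have hL1 : (1 : ℝ) < F.L := by exact_mod_cast F.one_lt_L
  have hL : (0 : ℝ) < F.L := zero_lt_one.trans hL1
  -- above the front some step drops below `β_exit` (Archimedes, as in `massGap_of_frontsMeet`)
  have hex : ∀ β, β_exit ≤ β → ∃ k : ℕ, F.betaEff β k < β_exit := by
    intro β hβe
    by_contra hno
    have hno' : ∀ k, β_exit ≤ F.betaEff β k := fun k => not_lt.1 fun hk => hno ⟨k, hk⟩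
    obtain ⟨n, hn⟩ := exists_nat_gt ((β - β_exit) / F.decr)
    have hle := hWC.betaEff_le hβe (k := n) (fun j _ => hno' j) (n + 1) le_rfl
    have hge := hno' (n + 1)
    have hdn : (β - β_exit) < n * F.decr := by rwa [div_lt_iff₀ F.decr_pos] at hn
    push_cast at hle
    nlinarith [F.decr_pos]
  -- the exit step as a function of `β` (first step below `β_exit`; `0` below the front)
  have hkf : ∃ kf : ℝ → ℕ, ∀ β, β_exit ≤ β →
      F.betaEff β (kf β) < β_exit ∧ ∀ j < kf β, β_exit ≤ F.betaEff β j := by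
    refine ⟨fun β => if h : β_exit ≤ β then Nat.find (hex β h) else 0, fun β h => ?_⟩
    simp only [dif_pos h]
    exact ⟨Nat.find_spec (hex β h), fun j hj => not_lt.1 (Nat.find_min (hex β h) hj)⟩
  obtain ⟨kstar, hk_spec⟩ := hkf
  -- the exit step is controlled (it is positive, and all earlier couplings are `≥ β_exit`)
  have hk_ctrl : ∀ β, β_exit ≤ β → F.Controlled β (kstar β) := by
    intro β hβe
    obtain ⟨hlt, hmin⟩ := hk_spec β hβe
    obtain ⟨⟨-, h0⟩, hstep⟩ := hWC β hβe
    have hk0 : kstar β ≠ 0 := by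
      intro hz
      rw [hz, h0] at hlt
      exact absurd hβe (not_le.2 hlt)
    obtain ⟨k₁, hk₁⟩ := Nat.exists_eq_succ_of_ne_zero hk0
    rw [hk₁]
    exact (hstep k₁ fun j hj => hmin j (by omega)).1
  -- two-sided steps: `β − k·D ≤ betaEff β k`
  have hlow : ∀ β, β_exit ≤ β → ∀ k : ℕ, β - k * D ≤ F.betaEff β k := by
    intro β hβe k
    obtain ⟨⟨-, h0⟩, -⟩ := hWC β hβe
    induction k with
    | zero => simp [h0]
    | succ i ih =>
      have := hD.2 β i
      push_cast
      linarith
  -- the exit-scale unit map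
  obtain ⟨a, ha⟩ : ∃ a : ℝ → ℝ, ∀ β, a β = ((F.L : ℝ) ^ kstar β)⁻¹ := ⟨_, fun _ => rfl⟩
  have hapos : ∀ β, 0 < a β := fun β => by rw [ha]; exact inv_pos.2 (pow_pos hL _)
  refine ⟨a, hapos, ?_, ?_, ?_⟩
  · -- `a → 0`: the exit step diverges because steps are bounded
    have hk_tend : Tendsto kstar atTop atTop := by
      refine tendsto_atTop_atTop.2 fun N => ⟨max β_exit (β_exit + N * D), fun β hβ => ?_⟩
      have hβe : β_exit ≤ β := (le_max_left _ _).trans hβ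
      have hβN : β_exit + N * D ≤ β := (le_max_right _ _).trans hβ
      by_contra hlt
      have hlt' : kstar β < N := not_le.1 hlt
      obtain ⟨hexit, -⟩ := hk_spec β hβe
      have h1 := hlow β hβe (kstar β)
      have h2 : ((kstar β : ℕ) : ℝ) * D ≤ (N : ℝ) * D := by
        have : ((kstar β : ℕ) : ℝ) ≤ N := by exact_mod_cast hlt'.le
        exact mul_le_mul_of_nonneg_right this hD.1.le
      linarith
    have hq : Tendsto (fun k : ℕ => ((F.L : ℝ)⁻¹) ^ k) atTop (𝓝 0) :=
      tendsto_pow_atTop_nhds_zero_of_lt_one (inv_nonneg.2 hL.le) (inv_lt_one_of_one_lt₀ hL1)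
    refine Tendsto.congr (fun β => ?_) (hq.comp hk_tend)
    rw [ha, Function.comp_apply, inv_pow]
  · -- `GapInUnits` at rate `m`, threshold `β_exit`, volume thresholds read at the exit step
    obtain ⟨hm, S₁, hS⟩ := hHO
    refine ⟨m, β_exit, fun β => S₁ β (kstar β), hm, fun A B => ?_⟩
    obtain ⟨C, hC⟩ := hS A B
    refine ⟨C, fun β hβe S n hSn hn => ?_⟩
    obtain ⟨hlt, -⟩ := hk_spec β hβe
    have h := hC β (kstar β) (hk_ctrl β hβe) (le_of_lt (hlt.trans_le hmeet)) S hSn n hn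
    have hrate : m / (F.L : ℝ) ^ kstar β * n = m * a β * n := by rw [ha, div_eq_mul_inv]
    rwa [hrate] at h
  · intro β hβe
    obtain ⟨hlt, hmin⟩ := hk_spec β hβe
    exact ⟨kstar β, ha β, hk_ctrl β hβe, hlt, hmin⟩

/-- **Clay from the fronts plus the UV-side legs at the exit scale** (composition of Part B with Part A): for every
compact simple `G`, SOME `r`, SOME flow interface `F` with a weak-coupling front at `β_exit`, a β-uniform hand-over at
`β₀ ≥ β_exit` and two-sided steps, and the three UV-side legs `UV ∧ NT ∧ ROT` granted for EVERY positive unit map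
`a → 0` that is the flow's exit-scale map above the front — give `_root_.YangMills`. -/
theorem yangMills_of_fronts
    (h : ∀ (G : Type) [Group G] [TopologicalSpace G] [IsTopologicalGroup G] [CompactSpace G],
      IsCompactSimpleLieGroup G → letI : MeasurableSpace G := borel G; haveI : BorelSpace G := ⟨rfl⟩;
      ∃ (r : LatticeRep G) (F : RGFlowControl) (β₀ β_exit m D : ℝ),
        WeakCouplingFront F β_exit ∧ HandOverU F r β₀ m ∧ β_exit ≤ β₀ ∧ BoundedDecrease F D ∧
        ∀ a : ℝ → ℝ, (∀ β, 0 < a β) → Tendsto a atTop (𝓝 0) →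
          (∀ β, β_exit ≤ β → ∃ k : ℕ, a β = ((F.L : ℝ) ^ k)⁻¹ ∧ F.Controlled β k ∧ F.betaEff β k < β_exit ∧
            ∀ j < k, β_exit ≤ F.betaEff β j) →
          UV G r a ∧ NT G r a ∧ ROT G r a) :
    YangMills := by
  refine yangMills_of_legs fun G _ _ _ _ hG => ?_
  letI : MeasurableSpace G := borel G
  haveI : BorelSpace G := ⟨rfl⟩
  obtain ⟨r, F, β₀, β_exit, m, D, hWC, hHO, hmeet, hD, hlegs⟩ := h G hG
  obtain ⟨a, hapos, ha0, hIR, hexit⟩ := gapInUnits_of_fronts r hWC hHO hmeet hD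
  obtain ⟨hUV, hNT, hROT⟩ := hlegs a hapos ha0 hexit
  exact ⟨r, a, hapos, ha0, hUV, hNT, hIR, hROT⟩

/-! ## The SU(2) instance of the window: H-b ∧ H-c^U at the certified door 1/6 ⇒ `HandOverU` ⇒ the IR leg

`AtTorusDoor`, `clustersWith_of_atTorusDoor`, `GibbsFormAtDoor` are verbatim the g0 sketch `ROUTE-P2-SketchP2.lean`
(memo §1, §3); new here: the β- and b-UNIFORM observable transport `ObservableTransportU` (H-c^U) and the glue to the
β-uniform hand-over and to the SU(2) window target with THE NUMBER (door `β_t ≤ 1/6`, i.e. `β_W,eff ≤ 1/3`) in it. -/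

namespace SU2

open Summit.Ventures.YMGap.RobustBall
open Literature.MathematicalPhysics.QuantumFieldTheory.Balaban1983to89

/-- `SU(2)`. -/
abbrev G2 : Type := Matrix.specialUnitaryGroup (Fin 2) ℂ

/-- **At the torus door** (g0 verbatim): effective inverse coupling in `[0, 1/6]`, localized terms in the tier-2 Dobrushin
ball `InBall κ (11/500) (11/1000)`, `κ ≥ 1/100` — the hypotheses of the tree row `su2_torusClusteringOnBallW_star_oneThird_t100`. -/
def AtTorusDoor {S : ℕ} [NeZero S] (𝓔 : BalabanEffectiveAction 4 S G2 1) (κ : ℝ) : Prop :=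
  0 ≤ 𝓔.β ∧ 𝓔.β ≤ 1 / 6 ∧ 1 / 100 ≤ κ ∧ InBall κ (11 / 500) (11 / 1000) 𝓔.terms

/-- **The matching statement, torus currency** (g0 verbatim; tree theorem): an effective action at the torus door
clusters with ONE constant `16 e^{1/50}` and ONE rate `1/100` in block units, on every block torus `S ≥ 3`. -/
theorem clustersWith_of_atTorusDoor {S : ℕ} [NeZero S] (hS : 3 ≤ S) (𝓔 : BalabanEffectiveAction 4 S G2 1) {κ : ℝ}
    (h : AtTorusDoor 𝓔 κ) : ClustersWith 𝓔.terms 𝓔.β (16 * Real.exp (1 / 50)) (1 / 100) :=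
  su2_torusClusteringOnBallW_star_oneThird_t100 κ h.2.2.1 𝓔.β h.1 h.2.1 S hS 𝓔.terms h.2.2.2

/-- **H-b, global Gibbs form at the door** (g0 verbatim; OPEN, node U-LF). -/
def GibbsFormAtDoor (F : RGFlowControl) (β₀ κ : ℝ) : Prop :=
  ∀ (β : ℝ) (k : ℕ), F.Controlled β k → F.betaEff β k ≤ β₀ →
    ∀ (b : ℕ) [NeZero b], b = F.L ^ k → ∀ (S : ℕ) [NeZero S], 3 ≤ S →
      ∃ (B : GaugeBlockAveraging 4 G2 b S) (𝓔 : BalabanEffectiveAction 4 S G2 1),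
        IsBalabanEffectiveActionOf (fundamentalRep (Fin 2)) B β 𝓔 ∧ AtTorusDoor 𝓔 κ

/-- **H-c^U, UNIFORM observable transport** (OPEN, node U-OBS; the β- and b-uniform sharpening of g0's
`ObservableTransport` that the continuum bridge needs): if at fine coupling `β` the theory blocked by the factor `b`
is, on every block torus `S ≥ 3`, the Gibbs measure of some Bałaban-format effective action clustering with `(A, m)`
in block units, then every pair of gauge-invariant local species clusters on all fine tori of side `≥ 2 S₁(β,b) + 1`
at lattice rate `m / b` with a constant depending on the species ONLY (not on `β`, `b`). -/
def ObservableTransportU (A m : ℝ) : Prop :=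
  ∃ S₁ : ℝ → ℕ → ℕ, ∀ (P Q : YMSpecies G2), ∃ C : ℝ, ∀ (β : ℝ) (b : ℕ) [NeZero b],
    (∀ (S : ℕ) [NeZero S], 3 ≤ S →
      ∃ (B : GaugeBlockAveraging 4 G2 b S) (𝓔 : BalabanEffectiveAction 4 S G2 1),
        IsBalabanEffectiveActionOf (fundamentalRep (Fin 2)) B β 𝓔 ∧ ClustersWith 𝓔.terms 𝓔.β A m) →
    ∀ S : ℕ, S₁ β b ≤ S → ∀ n : ℕ, n ≤ S →
      |latticeConnectedCorr (fundamentalLatticeRep 2).ρ β (2 * S + 1) P.F Q.F n| ≤ C * Real.exp (-(m / b * n))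

/-- **GLUE (proved): H-b + H-c^U + the hypothesis-free door ⇒ the β-uniform hand-over for SU(2) at
`(β₀, m) = (1/6, 1/100)`.** -/
theorem handOverU_of_split (F : RGFlowControl) {κ : ℝ} (hb : GibbsFormAtDoor F (1 / 6) κ)
    (hc : ObservableTransportU (16 * Real.exp (1 / 50)) (1 / 100)) :
    HandOverU F (fundamentalLatticeRep 2) (1 / 6) (1 / 100) := by
  obtain ⟨S₁, hc⟩ := hc
  refine ⟨by norm_num, fun β k => S₁ β (F.L ^ k), fun P Q => ?_⟩
  obtain ⟨C, hC⟩ := hc P Q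
  refine ⟨C, fun β k hctrl hle S hS n hn => ?_⟩
  have hL0 : F.L ≠ 0 := by have := F.one_lt_L; omega
  haveI : NeZero (F.L ^ k) := ⟨pow_ne_zero _ hL0⟩
  have h := hC β (F.L ^ k) (fun S _ hS3 => by
    obtain ⟨B, 𝓔, hrep, hdoor⟩ := hb β k hctrl hle (F.L ^ k) rfl S hS3
    exact ⟨B, 𝓔, hrep, clustersWith_of_atTorusDoor hS3 𝓔 hdoor⟩) S hS n hn
  simpa [Nat.cast_pow] using h

/-- **THE SU(2) WINDOW TARGET, fully typed (R2b/R2c as a window-closing target, memo §5.3):** a flow device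
controlled down to `β_exit` (H-a), with two-sided steps, the fronts MEETING at the certified door — `β_exit ≤ 1/6`
(tree coupling; `β_W ≤ 1/3`), THE NUMBER of §2 — and H-b, H-c^U at that door give the IR leg of the Clay bridge for
SU(2) at the exit-scale unit map, at rate `1/100` in those units. -/
theorem gapInUnits_su2_of_split (F : RGFlowControl) {β_exit κ D : ℝ} (hWC : WeakCouplingFront F β_exit)
    (hmeet : β_exit ≤ 1 / 6) (hb : GibbsFormAtDoor F (1 / 6) κ)
    (hc : ObservableTransportU (16 * Real.exp (1 / 50)) (1 / 100)) (hD : BoundedDecrease F D) :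
    ∃ a : ℝ → ℝ, (∀ β, 0 < a β) ∧ Tendsto a atTop (𝓝 0) ∧ GapInUnits G2 (fundamentalLatticeRep 2) a ∧
      ∀ β, β_exit ≤ β → ∃ k : ℕ, a β = ((F.L : ℝ) ^ k)⁻¹ ∧ F.Controlled β k ∧ F.betaEff β k < β_exit ∧
        ∀ j < k, β_exit ≤ F.betaEff β j :=
  gapInUnits_of_fronts (fundamentalLatticeRep 2) hWC (handOverU_of_split F hb hc) hmeet hD

/-- … hence, with UV ∧ NT ∧ ROT for SU(2) at the same unit map, SU(2) Yang–Mills OS data with both gaps (the `G = SU(2)`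
instance of the Clay conjunction's body, any compact G being allowed by `osDataWithGap_of_legs`). -/
theorem osDataWithGap_su2_of_split (F : RGFlowControl) {β_exit κ D : ℝ} (hWC : WeakCouplingFront F β_exit)
    (hmeet : β_exit ≤ 1 / 6) (hb : GibbsFormAtDoor F (1 / 6) κ)
    (hc : ObservableTransportU (16 * Real.exp (1 / 50)) (1 / 100)) (hD : BoundedDecrease F D)
    (hlegs : ∀ a : ℝ → ℝ, (∀ β, 0 < a β) → Tendsto a atTop (𝓝 0) →
      (∀ β, β_exit ≤ β → ∃ k : ℕ, a β = ((F.L : ℝ) ^ k)⁻¹ ∧ F.Controlled β k ∧ F.betaEff β k < β_exit ∧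
        ∀ j < k, β_exit ≤ F.betaEff β j) →
      UV G2 (fundamentalLatticeRep 2) a ∧ NT G2 (fundamentalLatticeRep 2) a ∧ ROT G2 (fundamentalLatticeRep 2) a) :
    ∃ (a : ℝ → ℝ) (sch : SpeciesScheme (YMSpecies G2)) (T : OSData (YMSpecies G2) 4),
      (∀ k, sch.a k = a (sch.β k)) ∧ sch.HasWeakCouplingLimit ∧ IsYangMillsFor (fundamentalLatticeRep 2) sch T ∧
        T.IsNontrivial (fundamentalLatticeRep 2).curvature ∧ T.IsNonGaussian (fundamentalLatticeRep 2).curvature ∧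
        ∃ Δ > 0, T.HasMassGap Δ ∧ HasLatticeMassGap (fundamentalLatticeRep 2) sch Δ := by
  obtain ⟨a, hapos, ha0, hIR, hexit⟩ := gapInUnits_su2_of_split F hWC hmeet hb hc hD
  obtain ⟨hUV, hNT, hROT⟩ := hlegs a hapos ha0 hexit
  obtain ⟨sch, T, h⟩ := osDataWithGap_of_legs (fundamentalLatticeRep 2) a hapos ha0 hUV hNT hIR hROT
  exact ⟨a, sch, T, h⟩

end SU2

end Window

end Summit.QuantumFields.YangMills.Cruxes.OSLegsAtWeakCouplingC.Y2Bridge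

end
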